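import Summits.CriticalPhenomena.PercolationContinuityZ3.Theorems.PercNearOneGluingNoHeavyLowerTailSahiSlotPatternThreeFour

/-!
# The slot table is KERNEL for `d ≤ 3, n ≤ 4`: Sahi's `E_n ≥ 0` COEFFICIENTWISE for every order `n ≤ 4` on every product of three finite chains

Support file of the one-cut programme (crux `NoHeavyLowerTail`, stmt-CriticalPhenomena-4575; cell `prim-masterthm`, seat P3, gen 19;
`run/shared/lean/prim/prim-masterthm/prim-masterthm-p3/HIERARCHY.md` §27).  Bundles the cells of the slot table (P3 gen 18: `SlotPatternPos d n`,
antitone in `d`) that are now theorems of the tree — `(d, n)` for `n ≤ 2` and every `d` (`slotPatternPos_zero_right/one/two`), `(3,3)` (prim-sahi's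
certificate, `slotPatternPos_three_three`) and `(3,4)` (this generation, `slotPatternPos_three_four`, computational) — into the statements one cites:
* `slotPatternPos_of_le_three_of_le_four : d ≤ 3 → n ≤ 4 → SlotPatternPos d n`;
* `liebSahiContinuum_of_le_three_of_le_four` — Lieb–Sahi's Conjecture 1.1 on `[0,1]^d`, `d ≤ 3`, at every order `n ≤ 4`;
* `sahiPositive_gridW_three_of_le_four` — every product probability weight on every product of three finite chains is Sahi-positive of every order `n ≤ 4`;
* `fkg_lattice_three_of_le_four` — and so is every FKG weight on every finite distributive lattice of J-width `≤ 3`.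
HONEST LABEL: packaging; inherits the computational status of `(3,4)`.  First open cells: `(3,5)`, `(4,4)`, `(d ≥ 5, 3)` (`(4,3)` certified by prim-sahi,
outside the kernel). [this work]
-/

namespace Summit.CriticalPhenomena.PercolationContinuityZ3.Theorems

namespace SahiSlot

open Finset
open Literature.Combinatorics.Sahi2008

variable {d n : ℕ}

/-- **The slot table for `d ≤ 3`, `n ≤ 4` is kernel.** [this work] -/
theorem slotPatternPos_of_le_three_of_le_four (hd : d ≤ 3) (hn : n ≤ 4) : SlotPatternPos d n := by
  interval_cases n
  · exact slotPatternPos_zero_right d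
  · exact slotPatternPos_one d
  · exact slotPatternPos_two d
  · exact slotPatternPos_three_three.of_le hd
  · exact slotPatternPos_three_four.of_le hd

/-- **Lieb–Sahi's Conjecture 1.1 on `[0,1]^d` for `d ≤ 3` at every order `n ≤ 4`.** [this work] -/
theorem liebSahiContinuum_of_le_three_of_le_four (hd : d ≤ 3) (hn : n ≤ 4) : LiebSahiContinuum d n :=
  liebSahiContinuum_of_slotPatternPos (slotPatternPos_of_le_three_of_le_four hd hn)

/-- **Every product probability weight on every product of three finite chains is Sahi-positive of every order `n ≤ 4`** (`Y` a finite linear order,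
`g_a` the axis weights; dimension `d ≤ 3`). [this work] -/
theorem sahiPositive_gridW_three_of_le_four {Y : Type*} [LinearOrder Y] [Fintype Y] (hd : d ≤ 3) (hn : n ≤ 4) (g : Fin d → Y → ℝ)
    (hg0 : ∀ a y, 0 ≤ g a y) (hg1 : ∀ a, ∑ y, g a y = 1) : SahiPositive (gridW g) n :=
  sahiPositive_gridW_of_slotPatternPos (slotPatternPos_of_le_three_of_le_four hd hn) g hg0 hg1

/-- **Every FKG weight on every finite distributive lattice of J-width `≤ 3` is Sahi-positive of every order `n ≤ 4`.** [this work] -/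
theorem fkg_lattice_three_of_le_four {L : Type*} [DistribLattice L] [Fintype L] [DecidableEq L] {b : ℕ} (hd : d ≤ 3) (hn : n ≤ 4)
    (e : L → (Fin d → Fin (b + 1))) (he : Function.Injective e) (hinf : ∀ x y, e (x ⊓ y) = e x ⊓ e y)
    (hsup : ∀ x y, e (x ⊔ y) = e x ⊔ e y) {μ : L → ℝ} (hμ : IsFKGMeasure μ) : SahiPositive μ n :=
  sahiPositive_of_slotPatternPos_of_latticeEmbedding (slotPatternPos_of_le_three_of_le_four hd hn) e he hinf hsup hμ

end SahiSlot

end Summit.CriticalPhenomena.PercolationContinuityZ3.Theorems
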